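import Mathlib.Analysis.InnerProductSpace.Projection.Basic
import Mathlib.Analysis.InnerProductSpace.Projection.FiniteDimensional
import Literature.NumberTheory.Automorphic.GKSubquotient
import Literature.NumberTheory.Automorphic.GKModulesProofs
import Literature.NumberTheory.Automorphic.KugaLemmaDegreeOne
import HarnessLib

/-!
# A non-zero admissible unitary `(𝔤, K)`-module has an irreducible `(𝔤, K)`-submodule

Topic `NumberTheory/Automorphic`; theorems only (no definition, no named fact, no `sorry`).

Let `(V, ρK, ρ𝔤)` be `(𝔤, K)`-module data for a linear real group `G` (`GKModules`) such that
every vector is `K`-finite, `ρK` is admissible (`IsAdmissibleGK`: finite `K`-multiplicities) and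
`V ≠ 0`, and let `⟪·, ·⟫` be a positive definite Hermitian form on `V` (`Kuga.IsPosForm`) which is
`K`-invariant and for which the orthogonal of every `(𝔤, K)`-submodule is `𝔤`-stable (e.g. `𝔤`
acts by skew-Hermitian operators up to central scalars: a unitary, or essentially unitary,
module).  THEN `V` has an IRREDUCIBLE `(𝔤, K)`-submodule (`exists_isIrreducibleGK_submodule`).

This is the algebraic half of the complete reducibility of admissible unitary representations
(Harish-Chandra; Knapp–Vogan 1995, Ch. IX §1; Wallach, *Real Reductive Groups I*, §1.3, §3.3.1;
Borel–Wallach 2000, 0 §2.5): orthogonal complements of invariant subspaces are invariant, and a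
minimality argument on a fixed `K`-isotypic component produces an irreducible summand.  Proof:
fix an irreducible `K`-type `τ` occurring in `V` (`K`-finiteness, `exists_minimal_stable_submodule`)
and its isotypic space `T = ∑_{f ∈ Hom_K(τ, V)} f(τ)`, finite-dimensional by admissibility; among the
`(𝔤, K)`-submodules `U` with `U ∩ T ≠ 0` choose one minimising `dim (U ∩ T) = dim T₁` and let `U₂`
be the `(𝔤, K)`-submodule generated by `T₁`.  A `(𝔤, K)`-submodule `U ≤ U₂` either meets `T`, and
then `U ∩ T = T₁` by minimality and `U = U₂`; or `U ∩ T = 0`, and then `T ⊥ U` — for `u ∈ U` the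
orthogonal projection onto the finite-dimensional `K`-stable `F = span (K u) ≤ U` is `K`-equivariant
(`K` acts by isometries), so it maps `f(τ)` (`f ∈ Hom_K(τ, V)`) by a `K`-map into `F ∩ T ≤ U ∩ T = 0` —
whence `U₂ ≤ U^⊥` (a `(𝔤, K)`-submodule containing `T₁`) and `U = 0`.
[cite: KnappVogan1995, Ch. IX §1] [cite: WallachRRG1, §3.3.1] [cite: BorelWallach2000, 0 §2.5]

## Mathlib

The positive form is turned into a local `InnerProductSpace ℂ V` (`InnerProductSpace.Core`,
`InnerProductSpace.ofCore`) to use `Submodule.orthogonal` and the orthogonal projection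
`Submodule.starProjection` onto finite-dimensional subspaces.

## References

* A. W. Knapp, D. A. Vogan, *Cohomological Induction and Unitary Representations* (1995), Ch. IX §1
  (held). [KnappVogan1995]
* N. R. Wallach, *Real Reductive Groups I* (1988), §1.3, §3.3.1. [WallachRRG1]
* A. Borel, N. Wallach (2000), 0 §2.5 (held). [BorelWallach2000]
-/

noncomputable section

-- Mathlib idiom (Mathlib/Algebra/Lie/OfAssociative.lean), as in `GKModules`: the commutator bracket on
-- `Module.End ℂ V`, needed to speak of `𝔤 →ₗ⁅ℝ⁆ Module.End ℂ V`
attribute [local instance 100] LieRing.ofAssociativeRing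

open scoped InnerProductSpace

namespace Literature.NumberTheory.Automorphic

namespace GKSubmodule

variable {A : Type*} [NormedCommRing A] [NormedAlgebra ℝ A] [NormedAlgebra ℚ A] [CompleteSpace A]
  [StarRing A] {N : Type*} [Fintype N] [DecidableEq N] {G : RealMatrixGroup A N}
  {V : Type*} [AddCommGroup V] [Module ℂ V]
  (ρK : Representation ℂ G.maximalCompact V) (ρ𝔤 : G.lie →ₗ⁅ℝ⁆ Module.End ℂ V)

/-- The intersection of a family of `(𝔤, K)`-submodules is a `(𝔤, K)`-submodule. [folklore] -/
theorem isGKSubmodule_sInf {S : Set (Submodule ℂ V)} (hS : ∀ U ∈ S, IsGKSubmodule ρK ρ𝔤 U) :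
    IsGKSubmodule ρK ρ𝔤 (sInf S) := by
  refine ⟨fun k w hw => ?_, fun X w hw => ?_⟩
  · rw [Submodule.mem_sInf] at hw ⊢
    exact fun U hU => (hS U hU).1 k w (hw U hU)
  · rw [Submodule.mem_sInf] at hw ⊢
    exact fun U hU => (hS U hU).2 X w (hw U hU)

/-- A `(𝔤, K)`-submodule of a `(𝔤, K)`-submodule `U` (for the restricted actions), pushed into `V`, is a
`(𝔤, K)`-submodule of `V`. [folklore] -/
theorem isGKSubmodule_map_subtype {U : Submodule ℂ V} (hU : IsGKSubmodule ρK ρ𝔤 U)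
    {U' : Submodule ℂ U}
    (hU' : IsGKSubmodule (ρK.subrepresentation U fun k u hu => hU.1 k u hu)
      (GKSubmodule.subLie G ρ𝔤 U fun X u hu => hU.2 X u hu) U') :
    IsGKSubmodule ρK ρ𝔤 (U'.map U.subtype) := by
  refine ⟨fun k w hw => ?_, fun X w hw => ?_⟩
  · obtain ⟨u, hu, rfl⟩ := hw
    exact ⟨_, hU'.1 k u hu, rfl⟩
  · obtain ⟨u, hu, rfl⟩ := hw
    exact ⟨_, hU'.2 X u hu, rfl⟩

/-- **A non-zero admissible `K`-finite `(𝔤, K)`-module with a `K`-invariant positive definite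
Hermitian form, for which orthogonals of `(𝔤, K)`-submodules are `𝔤`-stable, has an irreducible
`(𝔤, K)`-submodule** (complete reducibility of admissible unitary modules, existence half).
[cite: KnappVogan1995, Ch. IX §1] [cite: WallachRRG1, §3.3.1] [cite: BorelWallach2000, 0 §2.5] -/
theorem exists_isIrreducibleGK_submodule
    (hkf : ∀ v : V, FiniteDimensional ℂ (Submodule.span ℂ (Set.range fun k : G.maximalCompact ↦ ρK k v)))
    [Nontrivial V] (hadm : IsAdmissibleGK ρK) {ip : V → V → ℂ} (hip : Kuga.IsPosForm ip)
    (hK : ∀ (k : G.maximalCompact) (v w : V), ip (ρK k v) (ρK k w) = ip v w)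
    (h𝔤 : ∀ U : Submodule ℂ V, IsGKSubmodule ρK ρ𝔤 U → ∀ (X : G.lie) (v : V),
      (∀ u ∈ U, ip u v = 0) → ∀ u ∈ U, ip u (ρ𝔤 X v) = 0) :
    ∃ (U : Submodule ℂ V) (hU : IsGKSubmodule ρK ρ𝔤 U),
      IsIrreducibleGK (ρK.subrepresentation U fun k u hu => hU.1 k u hu)
        (GKSubmodule.subLie G ρ𝔤 U fun X u hu => hU.2 X u hu) := by
  classical
  -- the positive form as an inner product space structure on `V`
  let core : InnerProductSpace.Core ℂ V :=
    { inner := ip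
      conj_inner_symm := hip.conj_symm
      re_inner_nonneg := fun x => by rw [RCLike.re_to_complex]; exact hip.nonneg x
      add_left := hip.add_left
      smul_left := fun x y c => hip.smul_left c x y
      definite := hip.definite }
  letI i1 : NormedAddCommGroup V := @InnerProductSpace.Core.toNormedAddCommGroup ℂ V _ _ _ core
  letI i2 : InnerProductSpace ℂ V := InnerProductSpace.ofCore core.toCore
  have hinner : ∀ x y : V, ⟪x, y⟫_ℂ = ip x y := fun _ _ => rfl
  -- `K` acts by isometries: orthogonals of `K`-stable subspaces are `K`-stable
  have hKperp : ∀ U : Submodule ℂ V, (∀ k, ∀ u ∈ U, ρK k u ∈ U) → ∀ k, ∀ v ∈ Uᗮ, ρK k v ∈ Uᗮ := by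
    intro U hU k v hv
    rw [Submodule.mem_orthogonal] at hv ⊢
    intro u hu
    have h1 : ρK k (ρK k⁻¹ u) = u := by
      rw [← Module.End.mul_apply, ← map_mul, mul_inv_cancel, map_one, Module.End.one_apply]
    rw [hinner, ← h1, hK]
    exact hv _ (hU k⁻¹ u hu)
  -- orthogonals of `(𝔤, K)`-submodules are `(𝔤, K)`-submodules
  have hGKperp : ∀ U : Submodule ℂ V, IsGKSubmodule ρK ρ𝔤 U → IsGKSubmodule ρK ρ𝔤 Uᗮ := by
    intro U hU
    refine ⟨hKperp U hU.1, fun X v hv => ?_⟩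
    rw [Submodule.mem_orthogonal] at hv ⊢
    exact h𝔤 U hU X v hv
  -- Step 0: an irreducible `K`-type `τ` with an injective intertwiner `j` (by `K`-finiteness)
  obtain ⟨v, hv⟩ := exists_ne (0 : V)
  let F : Submodule ℂ V := Submodule.span ℂ (Set.range fun k : G.maximalCompact ↦ ρK k v)
  haveI : FiniteDimensional ℂ F := hkf v
  have hFK : ∀ k, ∀ w ∈ F, ρK k w ∈ F := by
    intro k w hw
    have hle : F.map (ρK k) ≤ F := by
      rw [Submodule.map_span, Submodule.span_le]
      rintro _ ⟨_, ⟨k', rfl⟩, rfl⟩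
      exact Submodule.subset_span ⟨k * k', by simp [map_mul]⟩
    exact hle (Submodule.mem_map_of_mem hw)
  have hvF : v ∈ F := Submodule.subset_span ⟨1, by simp⟩
  have hFne : F ≠ ⊥ := fun h => hv ((Submodule.eq_bot_iff F).mp h v hvF)
  obtain ⟨W₀, hW₀F, hW₀ne, hW₀K, hW₀min⟩ := exists_minimal_stable_submodule ρK F hFne hFK
  haveI : FiniteDimensional ℂ W₀ := Submodule.finiteDimensional_of_le hW₀F
  haveI : Nontrivial W₀ := Submodule.nontrivial_iff_ne_bot.mpr hW₀ne
  let W₀r : Subrepresentation ρK := ⟨W₀, fun k v hv => hW₀K k v hv⟩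
  let e : W₀ ≃ₗ[ℂ] (Fin (Module.finrank ℂ W₀) → ℂ) := (Module.finBasis ℂ W₀).equivFun
  let τ : Representation ℂ G.maximalCompact (Fin (Module.finrank ℂ W₀) → ℂ) :=
    e.conjRingEquiv.toMonoidHom.comp W₀r.toRepresentation
  have hτ : ∀ k y, τ k y = e (W₀r.toRepresentation k (e.symm y)) := fun k y => rfl
  have hτ' : ∀ (k) (w : W₀), ((W₀r.toRepresentation k w : W₀) : V) = ρK k w := fun k w => rfl
  let j : τ.IntertwiningMap ρK :=
    ⟨W₀.subtype ∘ₗ e.symm.toLinearMap, fun k => LinearMap.ext fun y => by simp [hτ, hτ']⟩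
  have hjapply : ∀ y, j y = ((e.symm y : W₀) : V) := fun y => rfl
  have hjinj : Function.Injective j := fun a b h => e.symm.injective (Subtype.ext h)
  have hjrange : LinearMap.range j.toLinearMap = W₀ := by
    change LinearMap.range (W₀.subtype ∘ₗ e.symm.toLinearMap) = W₀
    rw [LinearMap.range_comp, LinearEquiv.range, Submodule.map_top, Submodule.range_subtype]
  haveI : Nontrivial (Fin (Module.finrank ℂ W₀) → ℂ) := e.injective.nontrivial
  have hτirr : τ.IsIrreducible :=
    isIrreducible_of_intertwiningMap_injective ρK j hjinj (by
      rw [hjrange]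
      exact fun U hUK hUle => hW₀min U hUK hUle)
  haveI : FiniteDimensional ℂ (τ.IntertwiningMap ρK) := hadm _ τ hτirr
  -- Step 1: the `τ`-isotypic space `T = ∑_f f(τ)`, finite-dimensional, `K`-stable, non-zero
  let b := Pi.basisFun ℂ (Fin (Module.finrank ℂ W₀))
  let ev : Fin (Module.finrank ℂ W₀) → (τ.IntertwiningMap ρK →ₗ[ℂ] V) := fun i =>
    { toFun := fun f => f (b i)
      map_add' := fun f g => rfl
      map_smul' := fun c f => rfl }
  let T : Submodule ℂ V := ⨆ i, LinearMap.range (ev i)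
  haveI : FiniteDimensional ℂ T := Submodule.finiteDimensional_iSup _
  have hS : ∀ (f : τ.IntertwiningMap ρK) (w : Fin (Module.finrank ℂ W₀) → ℂ), f w ∈ T := by
    intro f w
    rw [← b.sum_repr w, map_sum]
    refine Submodule.sum_mem _ fun i _ => ?_
    rw [map_smul]
    exact Submodule.smul_mem _ _ (Submodule.mem_iSup_of_mem i ⟨f, rfl⟩)
  -- induction principle for `T`
  have hTind : ∀ {P : V → Prop}, (∀ (f : τ.IntertwiningMap ρK) (w : Fin (Module.finrank ℂ W₀) → ℂ), P (f w)) →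
      P 0 → (∀ x y, P x → P y → P (x + y)) → ∀ t ∈ T, P t := by
    intro P hgen h0 hadd t ht
    refine Submodule.iSup_induction _ (motive := P) ht (fun i s hs => ?_) h0 hadd
    obtain ⟨f, rfl⟩ := hs
    exact hgen f (b i)
  have hTK : ∀ k, ∀ t ∈ T, ρK k t ∈ T := by
    intro k
    refine hTind (fun f w => ?_) (by rw [map_zero]; exact T.zero_mem) (fun x y hx hy => by rw [map_add]; exact T.add_mem hx hy)
    rw [← f.isIntertwining]
    exact hS f _
  obtain ⟨w₁, hw₁⟩ : ∃ w, j w ≠ 0 := by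
    obtain ⟨b', hb', hb'0⟩ := Submodule.exists_mem_ne_zero_of_ne_bot hW₀ne
    refine ⟨e ⟨b', hb'⟩, ?_⟩
    rw [hjapply, LinearEquiv.symm_apply_apply]
    exact hb'0
  have hTne : T ≠ ⊥ := fun h => hw₁ ((Submodule.eq_bot_iff T).mp h _ (hS j w₁))
  -- Step 2 (KEY): a `K`-stable subspace `U` with `U ⊓ T = ⊥` is orthogonal to `T`
  have hkey : ∀ U : Submodule ℂ V, (∀ k, ∀ u ∈ U, ρK k u ∈ U) → U ⊓ T = ⊥ → T ≤ Uᗮ := by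
    intro U hUK hUT t ht
    rw [Submodule.mem_orthogonal]
    intro u hu
    -- the finite-dimensional `K`-stable `F_u = span (K u) ≤ U` and the orthogonal projection onto it
    let Fu : Submodule ℂ V := Submodule.span ℂ (Set.range fun k : G.maximalCompact ↦ ρK k u)
    haveI : FiniteDimensional ℂ Fu := hkf u
    have hFuK : ∀ k, ∀ w ∈ Fu, ρK k w ∈ Fu := by
      intro k w hw
      have hle : Fu.map (ρK k) ≤ Fu := by
        rw [Submodule.map_span, Submodule.span_le]
        rintro _ ⟨_, ⟨k', rfl⟩, rfl⟩
        exact Submodule.subset_span ⟨k * k', by simp [map_mul]⟩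
      exact hle (Submodule.mem_map_of_mem hw)
    have hFuU : Fu ≤ U := by
      rw [Submodule.span_le]
      rintro _ ⟨k, rfl⟩
      exact hUK k u hu
    have huFu : u ∈ Fu := Submodule.subset_span ⟨1, by simp⟩
    -- the orthogonal projection `P` onto `Fu` is `K`-equivariant
    let P : V →L[ℂ] V := Fu.starProjection
    have hPmem : ∀ x, P x ∈ Fu := fun x => Fu.starProjection_apply_mem x
    have hPK : ∀ k x, P (ρK k x) = ρK k (P x) := by
      intro k x
      refine Submodule.eq_starProjection_of_mem_orthogonal' (hFuK k _ (hPmem x))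
        (hKperp Fu hFuK k _ (Fu.sub_starProjection_mem_orthogonal x)) ?_
      rw [← map_add, add_sub_cancel]
    -- `P ∘ f` is an intertwiner `τ → V` with image in `U ⊓ T = ⊥`
    have hPf : ∀ (f : τ.IntertwiningMap ρK) (w : Fin (Module.finrank ℂ W₀) → ℂ), P (f w) = 0 := by
      intro f w
      let g : τ.IntertwiningMap ρK :=
        ⟨P.toLinearMap ∘ₗ f.toLinearMap, fun k => LinearMap.ext fun y => by
          simp only [LinearMap.coe_comp, Function.comp_apply, ContinuousLinearMap.coe_coe,
            Representation.IntertwiningMap.coe_toLinearMap]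
          rw [f.isIntertwining, hPK]⟩
      have hg : ∀ y, g y = P (f y) := fun y => rfl
      have h1 : P (f w) ∈ U ⊓ T := ⟨hFuU (hPmem _), by rw [← hg]; exact hS g w⟩
      rw [hUT, Submodule.mem_bot] at h1
      exact h1
    have hPt : P t = 0 :=
      hTind (P := fun x => P x = 0) hPf (map_zero P) (fun x y hx hy => by rw [map_add, hx, hy, add_zero]) t ht
    have ht' : t ∈ Fuᗮ := by
      have h := Fu.sub_starProjection_mem_orthogonal t
      rwa [show Fu.starProjection t = P t from rfl, hPt, sub_zero] at h
    exact (Submodule.mem_orthogonal Fu t).1 ht' u huFu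
  -- Step 3: a `(𝔤, K)`-submodule minimising `dim (U ⊓ T)` among those meeting `T`
  let S : Set (Submodule ℂ V) := {U | IsGKSubmodule ρK ρ𝔤 U ∧ U ⊓ T ≠ ⊥}
  have htopS : (⊤ : Submodule ℂ V) ∈ S := ⟨isGKSubmodule_top ρK ρ𝔤, by rwa [top_inf_eq]⟩
  let fd : Submodule ℂ V → ℕ := fun U => Module.finrank ℂ ↥(U ⊓ T)
  obtain ⟨U₁, hU₁⟩ : ∃ U₁ : Submodule ℂ V, Function.argminOn fd S ⟨⊤, htopS⟩ = U₁ := ⟨_, rfl⟩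
  obtain ⟨hU₁GK, hU₁T⟩ : U₁ ∈ S := hU₁ ▸ Function.argminOn_mem fd S ⟨⊤, htopS⟩
  have hU₁min : ∀ U ∈ S, fd U₁ ≤ fd U := fun U hU => hU₁ ▸ Function.argminOn_le fd S hU
  -- `T₁ = U₁ ⊓ T` and the `(𝔤, K)`-submodule `U₂` it generates
  let S₂ : Set (Submodule ℂ V) := {U | IsGKSubmodule ρK ρ𝔤 U ∧ U₁ ⊓ T ≤ U}
  let U₂ : Submodule ℂ V := sInf S₂
  have hU₂GK : IsGKSubmodule ρK ρ𝔤 U₂ := isGKSubmodule_sInf ρK ρ𝔤 fun U hU => hU.1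
  have hT₁U₂ : U₁ ⊓ T ≤ U₂ := le_sInf fun U hU => hU.2
  have hU₂U₁ : U₂ ≤ U₁ := sInf_le ⟨hU₁GK, inf_le_left⟩
  have hU₂T : U₂ ⊓ T = U₁ ⊓ T :=
    le_antisymm (inf_le_inf_right T hU₂U₁) (le_inf hT₁U₂ inf_le_right)
  -- Step 4: `U₂` is irreducible
  refine ⟨U₂, hU₂GK, ?_, fun U' hU' => ?_⟩
  · -- non-zero
    obtain ⟨x, hx, hx0⟩ := Submodule.exists_mem_ne_zero_of_ne_bot hU₁T
    exact ⟨⟨⟨x, hT₁U₂ hx⟩, 0, fun h => hx0 (congrArg Subtype.val h)⟩⟩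
  · -- a `(𝔤, K)`-submodule `U'` of `U₂`; push it into `V`
    let U : Submodule ℂ V := U'.map U₂.subtype
    have hUGK : IsGKSubmodule ρK ρ𝔤 U := isGKSubmodule_map_subtype ρK ρ𝔤 hU₂GK hU'
    have hUU₂ : U ≤ U₂ := by
      rintro _ ⟨u, -, rfl⟩
      exact u.2
    by_cases hUT : U ⊓ T = ⊥
    · -- `U ⊓ T = 0`: `T ⊥ U`, so `U₂ ≤ Uᗮ` and `U = 0`
      left
      have hTU : T ≤ Uᗮ := hkey U hUGK.1 hUT
      have hU₂perp : U₂ ≤ Uᗮ := sInf_le ⟨hGKperp U hUGK, inf_le_right.trans hTU⟩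
      have hUbot : U = ⊥ := by
        rw [Submodule.eq_bot_iff]
        intro u hu
        have h := (Submodule.mem_orthogonal U u).1 (hU₂perp (hUU₂ hu)) u hu
        exact hip.definite u h
      rw [Submodule.eq_bot_iff]
      intro u hu
      have : (u : V) ∈ U := ⟨u, hu, rfl⟩
      rw [hUbot, Submodule.mem_bot] at this
      exact Subtype.ext this
    · -- `U ⊓ T ≠ 0`: by minimality `U ⊓ T = T₁`, so `U₂ ≤ U`
      right
      have hUS : U ∈ S := ⟨hUGK, hUT⟩
      have hle : U ⊓ T ≤ U₁ ⊓ T := hU₂T ▸ inf_le_inf_right T hUU₂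
      haveI : FiniteDimensional ℂ ↥(U₁ ⊓ T) := Submodule.finiteDimensional_of_le inf_le_right
      have heq : U ⊓ T = U₁ ⊓ T := Submodule.eq_of_le_of_finrank_le hle (hU₁min U hUS)
      have hU₂U : U₂ ≤ U := sInf_le ⟨hUGK, heq ▸ inf_le_left⟩
      rw [Submodule.eq_top_iff']
      intro u
      obtain ⟨u', hu', hu'eq⟩ := hU₂U u.2
      have : u' = u := Subtype.ext hu'eq
      exact this ▸ hu'

end GKSubmodule

end Literature.NumberTheory.Automorphic

end
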